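import Literature.LinearAlgebra.BalancedBilinearFormAdjointDimension
import Literature.Geometry.Kaehler.ComplexTorusTotallyRealFieldCentralizerLefschetzLieAlgebraDimension
import HarnessLib

/-!
# Milne's table, TYPES II and III, every degree: `2[F:ℚ] · dim_ℚ Lie S(X) = g² + g[F:ℚ]` (II) and `= g² − g[F:ℚ]` (III) for a
# polarised complex torus whose endomorphism algebra is a QUATERNION algebra `F⟨I, J⟩` over a Rosati-fixed field `f(F)`, with
# `I† = −I` and `J† = J` (type II: `S(X) = Res_{F/ℚ} Sp_{g/[F:ℚ]}`, «Dimension `g²/2f + g/2`») resp. `J† = −J` (type III: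
# `Res_{F/ℚ} O_{g/[F:ℚ]}`, «`g²/2f − g/2`»)

Layer `Literature/Geometry/Kaehler`, namespace `Literature.Geometry.Kaehler.ComplexTorus`; lane `lit-hodgefound` (Track 2
foundations library); prover seat `lit-hodgefound-p17`, generation 59, self-proposed row g59-#4 — the quaternion twin of ✔ g59-#2
`ComplexTorusTotallyRealFieldCentralizerLefschetzLieAlgebraDimension` (type I) and ✔ g58-#9 (type IV, `d = 1`); the counting is ✔ g59-#3
(`LinearAlgebra/BalancedBilinearFormAdjointDimension` §3, on top of the tree's `Algebra/Lie/QuaternionCentralizerSkewDimensionForm`).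
THEOREMS ONLY (no definition, no instance, no notation, no named fact; D-0026 net debt `0`).  The ENGINE takes the quaternionic basis
`I, J` of `End_ℚ(X)` over `f(F)` with its Rosati signs as data (as the Summits-side `CorCM/LefschetzAlgebraQuaternionCentre` does on
the `HodgeTensorFacts` carriers); reading the signs off `IsAlbertTypeII ∕ III` + positivity (Lange Thm. 2.6.5 (b)(c)) is left to a sequel.

## Sources, VERBATIM (held `paper:doi-10-1215-s0012-7094-99-09620-5`)

* J. S. Milne [Milne1999LefschetzClasses], Duke Math. J. **96** (1999), §2 «Simple abelian variety of type II» p. 649–650 (p0011 L35 –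
  p0012 L37): «In this case `E` is a totally indefinite quaternion division algebra over `F` … `C(A) = C₁ × ⋯ × C_t` …
  `S(A)_{/k^al} = ∏_{σ:F→k^al} U(φ_{1,σ}) ∩ Sp(φ_{2,σ})` … `γ ↦ γ|V_{σ₁}` identifies `U(φ_{1,σ}) ∩ Sp(φ_{2,σ})` with `Sp(φ_{2,σ₁})`»;
  «Simple abelian variety of type III. This is similar to the preceding case, except …» (p0012 L38–L60); Summary table p. 652
  (p0014 L5–L20): «II ∣ `Sp` ∣ Yes ∣ Yes … III ∣ `O` ∣ Yes ∣ No …», dimensions `g²/2f + g/2`, `g²/2f − g/2` («The group `S(A)/k^{al}` is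
  isomorphic to `f` copies of the group listed»); §1 p. 644 «`S(A)(R) = {γ ∈ C(A) ⊗_k R ∣ γ†γ = 1}`».
* H. Lange [Lange2023AbelianVarietiesComplex], *Abelian Varieties over the Complex Numbers* (2023), Thm. 2.6.5 (b) («there is an element
  `a ∈ F` with `a² ∈ K` totally negative such that `x' = a⁻¹ x̄ a`»: then `a' = −a` and, for `j` anticommuting with `a` and pure,
  `j' = j`), (c) («`x' = x̄`»: pure quaternions are skew), §2.6.1 Proposition (table: II `2e ∣ g`, III `2e ∣ g`).
* V. K. Murty [Murty1984ExceptionalHodgeClasses], Math. Ann. **268** (1984), §2 (the Lefschetz group as the centraliser of `End⁰` in `Sp`).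

## What is proved

* §1 (`(K, f, I, J)` currency; ANY alternating non-degenerate rational `G` whose involution `A ↦ G⁻¹ ᵗA G` fixes `f(K)` pointwise, with
  `End_ℚ(X) = f(K) ⊕ f(K)I ⊕ f(K)J ⊕ f(K)IJ`, `I² = f(a)`, `J² = f(b)`, `a, b ∈ K×`, `IJ = −JI`, `I, J` commuting with `f(K)`, `I† = −I`):
  **`eight_mul_finrank_mul_finrank_lefschetzLieRat_add_eq_of_quaternion_of_rosati_eq_neg`** (`J† = −J`, type III:
  `8[K:ℚ]·dim_ℚ Lie S(X) + 2[K:ℚ]·#ι = #ι²`) and **`eight_mul_finrank_mul_finrank_lefschetzLieRat_eq_of_quaternion_of_rosati_eq_self`**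
  (`J† = J`, type II: `8[K:ℚ]·dim = #ι² + 2[K:ℚ]·#ι`).
* §2 In the dimension `g` (`#ι = 2g`): **`two_mul_finrank_mul_finrank_lefschetzLieRat_add_eq_of_quaternion_of_rosati_eq_neg`**
  (III: `2[K:ℚ]·dim Lie S(X) + g[K:ℚ] = g²`, «`g²/2f − g/2`»), **`two_mul_finrank_mul_finrank_lefschetzLieRat_eq_of_quaternion_of_rosati_eq_self`**
  (II: `2[K:ℚ]·dim Lie S(X) = g² + g[K:ℚ]`, «`g²/2f + g/2`»), the `𝔩𝔣` (ℝ) and `𝔩𝔣_ℂ` forms, and the Hodge bounds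
  `two_mul_finrank_mul_finrank_hodgeGroupLie_le_of_quaternion_…` (`Hg ⊆ Lf`).
-/

noncomputable section

open scoped Matrix
open Module Matrix Complex Function NumberField
open Literature.LinearAlgebra.BalancedForm (eight_mul_finrank_mul_finrank_add_eq_of_skew_skew
  eight_mul_finrank_mul_finrank_eq_of_skew_self)

namespace Literature.Geometry.Kaehler

namespace ComplexTorus

section Quaternion

variable {ι : Type} [Fintype ι] [DecidableEq ι] {E : Type} [NormedAddCommGroup E] [NormedSpace ℂ E]
  {Φ : (ι → ℝ) ≃L[ℝ] E} {η : E [⋀^Fin 2]→L[ℝ] ℝ} {G : Matrix ι ι ℚ}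
  {K : Type} [Field K] [NumberField K]

omit [DecidableEq ι] in
/-- `(A v) · (M w) = v · ((ᵗA M) w)`. [folklore] -/
private theorem mulVec_dotProduct_mulVec' (A M : Matrix ι ι ℚ) (v w : ι → ℚ) :
    (A *ᵥ v) ⬝ᵥ (M *ᵥ w) = v ⬝ᵥ ((Aᵀ * M) *ᵥ w) := by
  rw [dotProduct_comm, dotProduct_mulVec, ← mulVec_transpose, dotProduct_comm, mulVec_mulVec]

/-- Two matrices with the same bilinear form `ᵗv M w` are equal. [folklore] -/
private theorem eq_of_forall_dotProduct_mulVec_eq' {M N : Matrix ι ι ℚ} (h : ∀ v w : ι → ℚ, v ⬝ᵥ (M *ᵥ w) = v ⬝ᵥ (N *ᵥ w)) :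
    M = N :=
  (Matrix.toLinearMap₂' ℚ (n := ι) (m := ι)).injective (LinearMap.ext fun v ↦ LinearMap.ext fun w ↦ by
    rw [Matrix.toLinearMap₂'_apply', Matrix.toLinearMap₂'_apply', h])

/-- `ᵗA G = ε G A` ⟺ `ψ(Av, w) = ε ψ(v, Aw)` read through `Matrix.toLin'`, for `ε = −1`: skewness. [cite: Milne1999LefschetzClasses, §1 p. 644] -/
private theorem transpose_mul_eq_neg_iff (A : Matrix ι ι ℚ) :
    Aᵀ * G = -(G * A) ↔ ∀ v w : ι → ℚ,
      Matrix.toLinearMap₂' ℚ G (Matrix.toLin' A v) w = -Matrix.toLinearMap₂' ℚ G v (Matrix.toLin' A w) := by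
  constructor
  · intro h v w
    rw [Matrix.toLinearMap₂'_apply', Matrix.toLinearMap₂'_apply', Matrix.toLin'_apply, Matrix.toLin'_apply,
      mulVec_dotProduct_mulVec', h, Matrix.neg_mulVec, dotProduct_neg, mulVec_mulVec]
  · intro h
    refine eq_of_forall_dotProduct_mulVec_eq' fun v w ↦ ?_
    have hvw := h v w
    rw [Matrix.toLinearMap₂'_apply', Matrix.toLinearMap₂'_apply', Matrix.toLin'_apply, Matrix.toLin'_apply,
      mulVec_dotProduct_mulVec', mulVec_mulVec] at hvw
    rw [hvw, Matrix.neg_mulVec, dotProduct_neg]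

/-- `ᵗA G = G A` ⟺ `ψ(Av, w) = ψ(v, Aw)`: self-adjointness. [cite: Milne1999LefschetzClasses, §1 p. 644] -/
private theorem transpose_mul_eq_iff (A : Matrix ι ι ℚ) :
    Aᵀ * G = G * A ↔ ∀ v w : ι → ℚ,
      Matrix.toLinearMap₂' ℚ G (Matrix.toLin' A v) w = Matrix.toLinearMap₂' ℚ G v (Matrix.toLin' A w) := by
  constructor
  · intro h v w
    rw [Matrix.toLinearMap₂'_apply', Matrix.toLinearMap₂'_apply', Matrix.toLin'_apply, Matrix.toLin'_apply,
      mulVec_dotProduct_mulVec', h, mulVec_mulVec]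
  · intro h
    refine eq_of_forall_dotProduct_mulVec_eq' fun v w ↦ ?_
    have hvw := h v w
    rw [Matrix.toLinearMap₂'_apply', Matrix.toLinearMap₂'_apply', Matrix.toLin'_apply, Matrix.toLin'_apply,
      mulVec_dotProduct_mulVec', mulVec_mulVec] at hvw
    rw [hvw]

/-- A matrix commuting with `f(K)` is a `K`-LINEAR endomorphism of `ℚ^ι` (through `f`). [cite: Milne1999LefschetzClasses, §2 p. 646 («Any `k`-linear map … commuting with the action of `F`»)] -/
private theorem exists_linearMap_of_comm [Module K (ι → ℚ)] (f : K →ₐ[ℚ] Matrix ι ι ℚ)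
    (hsmul : ∀ (y : K) (v : ι → ℚ), y • v = f y *ᵥ v) {A : Matrix ι ι ℚ} (hA : ∀ x, A * f x = f x * A) :
    ∃ u : (ι → ℚ) →ₗ[K] (ι → ℚ), ∀ v, u v = A *ᵥ v :=
  ⟨{ toFun := fun v ↦ A *ᵥ v, map_add' := fun v w ↦ mulVec_add _ _ _,
      map_smul' := fun y v ↦ by rw [hsmul, hsmul, mulVec_mulVec, mulVec_mulVec, hA, RingHom.id_apply] }, fun _ ↦ rfl⟩

/-- **THE COMMON ENGINE OF TYPES II AND III**, for any alternating non-degenerate rational `G` whose involution fixes `f(K)` pointwise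
and `End_ℚ(X) = f(K) ⊕ f(K)I ⊕ f(K)J ⊕ f(K)IJ` a quaternion algebra over `f(K)` with `I† = −I`: `Lie S(X)`, transported to `End_ℚ(ℚ^ι)`,
is cut out by «`K`-linear, commutes with `I` and `J`, `ψ`-skew» (`ψ(v, w) = ᵗv G w` balanced), so that g59-#3's counts apply:
`8[K:ℚ]·dim Lie S(X) + 2[K:ℚ]#ι = #ι²` when `J† = −J` and `8[K:ℚ]·dim Lie S(X) = #ι² + 2[K:ℚ]#ι` when `J† = J`.
[cite: Milne1999LefschetzClasses, §2 p. 649–651 (types II, III) and Summary table p. 652] [cite: Murty1984ExceptionalHodgeClasses, §2] -/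
private theorem quaternion_engine (hGu : IsUnit G.det) (hGt : Gᵀ = -G) (f : K →ₐ[ℚ] Matrix ι ι ℚ)
    (hfix : ∀ x, rosati G (f x) = f x) {I J : Matrix ι ι ℚ} {a b : K} (ha : a ≠ 0) (hb : b ≠ 0) (hI : I * I = f a)
    (hJ : J * J = f b) (hIJ : I * J = -(J * I)) (hIf : ∀ x, I * f x = f x * I) (hJf : ∀ x, J * f x = f x * J)
    (hE : ∀ B, B ∈ endAlgRat Φ ↔ ∃ c : Fin 4 → K, B = f (c 0) + f (c 1) * I + f (c 2) * J + f (c 3) * (I * J))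
    (hIros : rosati G I = -I) :
    (rosati G J = -J →
      8 * (finrank ℚ K * finrank ℚ (lefschetzLieRat Φ G)) + 2 * (finrank ℚ K * Fintype.card ι) = Fintype.card ι * Fintype.card ι) ∧
    (rosati G J = J →
      8 * (finrank ℚ K * finrank ℚ (lefschetzLieRat Φ G)) = Fintype.card ι * Fintype.card ι + 2 * (finrank ℚ K * Fintype.card ι)) := by
  letI : LieRing (Matrix ι ι ℚ) := LieRing.ofAssociativeRing
  -- `ℚ^ι` as a `K`-space through `f`
  let f' : K →+* Module.End ℚ (ι → ℚ) :=
    ((Matrix.toLinAlgEquiv' : Matrix ι ι ℚ ≃ₐ[ℚ] Module.End ℚ (ι → ℚ)) : Matrix ι ι ℚ →+* Module.End ℚ (ι → ℚ)).comp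
      (f : K →+* Matrix ι ι ℚ)
  letI instK : Module K (ι → ℚ) := Module.compHom (ι → ℚ) f'
  have smul_def : ∀ (y : K) (v : ι → ℚ), y • v = f y *ᵥ v := fun y v ↦ Matrix.toLin'_apply (f y) v
  haveI : IsScalarTower ℚ K (ι → ℚ) :=
    ⟨fun q y v ↦ by rw [smul_def, smul_def, map_smul, Matrix.smul_mulVec]⟩
  -- the balanced alternating non-degenerate form `ψ(v, w) = ᵗv G w`
  set ψ : (ι → ℚ) →ₗ[ℚ] (ι → ℚ) →ₗ[ℚ] ℚ := Matrix.toLinearMap₂' ℚ G with hψdef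
  have hbal : ∀ (e : K) (v w : ι → ℚ), ψ (e • v) w = ψ v (e • w) := fun e v w ↦ by
    rw [hψdef, Matrix.toLinearMap₂'_apply', Matrix.toLinearMap₂'_apply', smul_def, smul_def, mulVec_dotProduct_mulVec',
      (rosati_eq_iff hGu _ _).1 (hfix e), mulVec_mulVec]
  have halt : ∀ v w : ι → ℚ, ψ w v = -ψ v w := fun v w ↦ by
    rw [hψdef, Matrix.toLinearMap₂'_apply', Matrix.toLinearMap₂'_apply', dotProduct_mulVec w G v, ← mulVec_transpose, hGt,
      Matrix.neg_mulVec, dotProduct_comm, dotProduct_neg]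
  have hN : ψ.SeparatingLeft := by
    rw [hψdef]; exact LinearMap.separatingLeft_toLinearMap₂'_iff_det_ne_zero.2 hGu.ne_zero
  -- `I`, `J` as `K`-linear maps
  obtain ⟨i, hi⟩ := exists_linearMap_of_comm f smul_def hIf
  obtain ⟨j, hj⟩ := exists_linearMap_of_comm f smul_def hJf
  have hres_i : ∀ v, i v = Matrix.toLin' I v := fun v ↦ by rw [hi, Matrix.toLin'_apply]
  have hres_j : ∀ v, j v = Matrix.toLin' J v := fun v ↦ by rw [hj, Matrix.toLin'_apply]
  have alg_apply : ∀ (c : K) (v : ι → ℚ), (algebraMap K (Module.End K (ι → ℚ)) c) v = f c *ᵥ v := fun c v ↦ by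
    rw [Module.algebraMap_end_apply, smul_def]
  have hii : i * i = algebraMap K (Module.End K (ι → ℚ)) a := LinearMap.ext fun v ↦ by
    rw [Module.End.mul_apply, hi, hi, mulVec_mulVec, hI, alg_apply]
  have hjj : j * j = algebraMap K (Module.End K (ι → ℚ)) b := LinearMap.ext fun v ↦ by
    rw [Module.End.mul_apply, hj, hj, mulVec_mulVec, hJ, alg_apply]
  have hij : i * j = -(j * i) := LinearMap.ext fun v ↦ by
    rw [Module.End.mul_apply, LinearMap.neg_apply, Module.End.mul_apply, hi, hj, hj, hi, mulVec_mulVec, mulVec_mulVec, hIJ,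
      Matrix.neg_mulVec]
  have hiψ : ∀ v w, ψ (i v) w = -ψ v (i w) := by
    intro v w; rw [hres_i, hres_i]; exact (transpose_mul_eq_neg_iff I).1 ((rosati_eq_iff hGu _ _).1 hIros ▸ by rw [Matrix.mul_neg]) v w
  -- `f x`, `I`, `J` lie in `End_ℚ(X)`
  have hfmem : ∀ x, f x ∈ endAlgRat Φ := fun x ↦ (hE _).2 ⟨![x, 0, 0, 0], by simp⟩
  have hImem : I ∈ endAlgRat Φ := (hE _).2 ⟨![0, 1, 0, 0], by simp⟩
  have hJmem : J ∈ endAlgRat Φ := (hE _).2 ⟨![0, 0, 1, 0], by simp⟩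
  -- commuting with `End_ℚ(X)` ⟺ commuting with `f(K)`, `I`, `J`
  have hcommE : ∀ A : Matrix ι ι ℚ, (∀ B ∈ endAlgRat Φ, A * B = B * A) ↔
      (∀ x, A * f x = f x * A) ∧ A * I = I * A ∧ A * J = J * A := by
    intro A
    constructor
    · intro h
      exact ⟨fun x ↦ h _ (hfmem x), h _ hImem, h _ hJmem⟩
    · rintro ⟨hf, hI', hJ'⟩ B hB
      obtain ⟨c, rfl⟩ := (hE B).1 hB
      have hIJ' : A * (I * J) = I * J * A := by rw [← Matrix.mul_assoc, hI', Matrix.mul_assoc, hJ', Matrix.mul_assoc]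
      have t1 : A * (f (c 1) * I) = f (c 1) * I * A := by rw [← Matrix.mul_assoc, hf, Matrix.mul_assoc, hI', ← Matrix.mul_assoc]
      have t2 : A * (f (c 2) * J) = f (c 2) * J * A := by rw [← Matrix.mul_assoc, hf, Matrix.mul_assoc, hJ', ← Matrix.mul_assoc]
      have t3 : A * (f (c 3) * (I * J)) = f (c 3) * (I * J) * A := by
        rw [← Matrix.mul_assoc, hf, Matrix.mul_assoc, hIJ', ← Matrix.mul_assoc]
      simp only [Matrix.mul_add, Matrix.add_mul, hf, t1, t2, t3]
  -- `Lie S(X)` transported to `End_ℚ(ℚ^ι)` and its membership test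
  let e : Matrix ι ι ℚ ≃ₗ[ℚ] Module.End ℚ (ι → ℚ) := Matrix.toLin'
  set S : Submodule ℚ (Module.End ℚ (ι → ℚ)) := (lefschetzLieRat Φ G).toSubmodule.map (e : Matrix ι ι ℚ →ₗ[ℚ] _) with hSdef
  have key : ∀ A : Matrix ι ι ℚ, A ∈ lefschetzLieRat Φ G ↔
      (∀ (c : K) (v : ι → ℚ), Matrix.toLin' A (c • v) = c • Matrix.toLin' A v) ∧ (∀ v, Matrix.toLin' A (i v) = i (Matrix.toLin' A v)) ∧
        (∀ v, Matrix.toLin' A (j v) = j (Matrix.toLin' A v)) ∧ ∀ v w, ψ (Matrix.toLin' A v) w = -ψ v (Matrix.toLin' A w) := by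
    intro A
    rw [mem_lefschetzLieRat_iff, and_comm, hcommE, hψdef, transpose_mul_eq_neg_iff A, and_assoc, and_assoc]
    refine and_congr ?_ (and_congr ?_ (and_congr ?_ Iff.rfl))
    · constructor
      · intro h c v
        rw [smul_def, smul_def, Matrix.toLin'_apply, Matrix.toLin'_apply, mulVec_mulVec, mulVec_mulVec, h c]
      · intro h x
        refine Matrix.toLin'.injective (LinearMap.ext fun v ↦ ?_)
        have hv := h x v
        rw [smul_def, smul_def, Matrix.toLin'_apply, Matrix.toLin'_apply, mulVec_mulVec, mulVec_mulVec] at hv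
        rw [Matrix.toLin'_apply, Matrix.toLin'_apply, hv]
    · constructor
      · intro h v
        rw [hi, hi, Matrix.toLin'_apply, Matrix.toLin'_apply, mulVec_mulVec, mulVec_mulVec, h]
      · intro h
        refine Matrix.toLin'.injective (LinearMap.ext fun v ↦ ?_)
        have hv := h v
        rw [hi, hi, Matrix.toLin'_apply, Matrix.toLin'_apply, mulVec_mulVec, mulVec_mulVec] at hv
        rw [Matrix.toLin'_apply, Matrix.toLin'_apply, hv]
    · constructor
      · intro h v
        rw [hj, hj, Matrix.toLin'_apply, Matrix.toLin'_apply, mulVec_mulVec, mulVec_mulVec, h]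
      · intro h
        refine Matrix.toLin'.injective (LinearMap.ext fun v ↦ ?_)
        have hv := h v
        rw [hj, hj, Matrix.toLin'_apply, Matrix.toLin'_apply, mulVec_mulVec, mulVec_mulVec] at hv
        rw [Matrix.toLin'_apply, Matrix.toLin'_apply, hv]
  have hS : ∀ u : Module.End ℚ (ι → ℚ), u ∈ S ↔ (∀ (c : K) (v : ι → ℚ), u (c • v) = c • u v) ∧ (∀ v, u (i v) = i (u v)) ∧
      (∀ v, u (j v) = j (u v)) ∧ ∀ v w, ψ (u v) w = -ψ v (u w) := by
    intro u
    rw [hSdef, Submodule.mem_map]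
    constructor
    · rintro ⟨A, hA, rfl⟩
      exact (key A).1 hA
    · intro hu
      refine ⟨Matrix.toLin'.symm u, ?_, LinearEquiv.apply_symm_apply _ _⟩
      rw [LieSubalgebra.mem_toSubmodule, key, LinearEquiv.apply_symm_apply]
      exact hu
  have hfin : finrank ℚ S = finrank ℚ (lefschetzLieRat Φ G).toSubmodule := by rw [hSdef, LinearEquiv.finrank_map_eq]
  refine ⟨fun hJros ↦ ?_, fun hJros ↦ ?_⟩
  · have hjψ : ∀ v w, ψ (j v) w = -ψ v (j w) := by
      intro v w; rw [hres_j, hres_j]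
      exact (transpose_mul_eq_neg_iff J).1 ((rosati_eq_iff hGu _ _).1 hJros ▸ by rw [Matrix.mul_neg]) v w
    have h := eight_mul_finrank_mul_finrank_add_eq_of_skew_skew hbal halt hN ha hb hii hjj hij hiψ hjψ S hS
    rw [hfin, finrank_fintype_fun_eq_card] at h
    exact h
  · have hjψ : ∀ v w, ψ (j v) w = ψ v (j w) := by
      intro v w; rw [hres_j, hres_j]
      exact (transpose_mul_eq_iff J).1 ((rosati_eq_iff hGu _ _).1 hJros) v w
    have h := eight_mul_finrank_mul_finrank_eq_of_skew_self hbal halt hN ha hb hii hjj hij hiψ hjψ S hS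
    rw [hfin, finrank_fintype_fun_eq_card] at h
    exact h

/-- **TYPE III ENGINE (`I† = −I`, `J† = −J`: the canonical involution on the pure quaternions): `8[K:ℚ] · dim_ℚ Lie S(X) + 2[K:ℚ] · #ι = #ι²`**
for any alternating non-degenerate rational `G` whose involution fixes `f(K)` pointwise and `End_ℚ(X) = f(K)⟨I, J⟩` a quaternion algebra
(`Lie S(X) = Res_{K/ℚ}` of the `K`-Lie algebra `C_K(I, J) ∩ 𝔰𝔭(V, φ)`, «III ∣ `O` … `g²/2f − g/2`»).
[cite: Milne1999LefschetzClasses, §2 p. 650–651 (type III) and Summary table p. 652] [cite: Murty1984ExceptionalHodgeClasses, §2] -/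
theorem eight_mul_finrank_mul_finrank_lefschetzLieRat_add_eq_of_quaternion_of_rosati_eq_neg (hGu : IsUnit G.det) (hGt : Gᵀ = -G)
    (f : K →ₐ[ℚ] Matrix ι ι ℚ) (hfix : ∀ x, rosati G (f x) = f x) {I J : Matrix ι ι ℚ} {a b : K} (ha : a ≠ 0) (hb : b ≠ 0)
    (hI : I * I = f a) (hJ : J * J = f b) (hIJ : I * J = -(J * I)) (hIf : ∀ x, I * f x = f x * I) (hJf : ∀ x, J * f x = f x * J)
    (hE : ∀ B, B ∈ endAlgRat Φ ↔ ∃ c : Fin 4 → K, B = f (c 0) + f (c 1) * I + f (c 2) * J + f (c 3) * (I * J))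
    (hIros : rosati G I = -I) (hJros : rosati G J = -J) :
    8 * (finrank ℚ K * finrank ℚ (lefschetzLieRat Φ G)) + 2 * (finrank ℚ K * Fintype.card ι) = Fintype.card ι * Fintype.card ι :=
  (quaternion_engine hGu hGt f hfix ha hb hI hJ hIJ hIf hJf hE hIros).1 hJros

/-- **TYPE II ENGINE (`I† = −I`, `J† = J`: the involution `x ↦ I⁻¹ x̄ I`): `8[K:ℚ] · dim_ℚ Lie S(X) = #ι² + 2[K:ℚ] · #ι`**
(`Lie S(X) = Res_{K/ℚ}` of `C_K(I, J) ∩ 𝔰𝔭(V, φ) ≅ 𝔰𝔭(V₁, φ₂|V₁)`, «II ∣ `Sp` … `g²/2f + g/2`»).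
[cite: Milne1999LefschetzClasses, §2 p. 649–650 (type II) and Summary table p. 652] [cite: Murty1984ExceptionalHodgeClasses, §2] -/
theorem eight_mul_finrank_mul_finrank_lefschetzLieRat_eq_of_quaternion_of_rosati_eq_self (hGu : IsUnit G.det) (hGt : Gᵀ = -G)
    (f : K →ₐ[ℚ] Matrix ι ι ℚ) (hfix : ∀ x, rosati G (f x) = f x) {I J : Matrix ι ι ℚ} {a b : K} (ha : a ≠ 0) (hb : b ≠ 0)
    (hI : I * I = f a) (hJ : J * J = f b) (hIJ : I * J = -(J * I)) (hIf : ∀ x, I * f x = f x * I) (hJf : ∀ x, J * f x = f x * J)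
    (hE : ∀ B, B ∈ endAlgRat Φ ↔ ∃ c : Fin 4 → K, B = f (c 0) + f (c 1) * I + f (c 2) * J + f (c 3) * (I * J))
    (hIros : rosati G I = -I) (hJros : rosati G J = J) :
    8 * (finrank ℚ K * finrank ℚ (lefschetzLieRat Φ G)) = Fintype.card ι * Fintype.card ι + 2 * (finrank ℚ K * Fintype.card ι) :=
  (quaternion_engine hGu hGt f hfix ha hb hI hJ hIJ hIf hJf hE hIros).2 hJros

/-! ## §2 In the dimension `g = dim X` (`#ι = 2g`): `2[K:ℚ] · dim Lie S(X) = g² ∓ g[K:ℚ]`, and the Hodge bounds -/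

variable [FiniteDimensional ℂ E]

/-- **MILNE'S TABLE, TYPE III: `2[F:ℚ] · dim_ℚ Lie S(X) + g[F:ℚ] = g²`** (`dim S(X) = g²/2f − g/2`, `S(X)_{/k^al} ≅ ∏_σ O_{g/f}`), for a
polarisation-type rational `G` of the torus `X = E/Φ(ℤ^ι)` of dimension `g` and `End_ℚ(X) = f(F)⟨I, J⟩` with `I† = −I`, `J† = −J`.
[cite: Milne1999LefschetzClasses, §2 p. 650–651 (type III) and Summary table p. 652 («III ∣ O ∣ … ∣ `g²/2f − g/2`»)] -/
theorem two_mul_finrank_mul_finrank_lefschetzLieRat_add_eq_of_quaternion_of_rosati_eq_neg (hGu : IsUnit G.det) (hGt : Gᵀ = -G)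
    (f : K →ₐ[ℚ] Matrix ι ι ℚ) (hfix : ∀ x, rosati G (f x) = f x) {I J : Matrix ι ι ℚ} {a b : K} (ha : a ≠ 0) (hb : b ≠ 0)
    (hI : I * I = f a) (hJ : J * J = f b) (hIJ : I * J = -(J * I)) (hIf : ∀ x, I * f x = f x * I) (hJf : ∀ x, J * f x = f x * J)
    (hE : ∀ B, B ∈ endAlgRat Φ ↔ ∃ c : Fin 4 → K, B = f (c 0) + f (c 1) * I + f (c 2) * J + f (c 3) * (I * J))
    (hIros : rosati G I = -I) (hJros : rosati G J = -J) :
    2 * (finrank ℚ K * finrank ℚ (lefschetzLieRat Φ G)) + finrank ℚ K * finrank ℂ E = finrank ℂ E ^ 2 := by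
  have h := eight_mul_finrank_mul_finrank_lefschetzLieRat_add_eq_of_quaternion_of_rosati_eq_neg hGu hGt f hfix ha hb hI hJ hIJ hIf
    hJf hE hIros hJros
  rw [card_eq_two_mul_finrank Φ] at h
  have h' : 4 * (2 * (finrank ℚ K * finrank ℚ (lefschetzLieRat Φ G)) + finrank ℚ K * finrank ℂ E) = 4 * finrank ℂ E ^ 2 :=
    calc _ = 8 * (finrank ℚ K * finrank ℚ (lefschetzLieRat Φ G)) + 2 * (finrank ℚ K * (2 * finrank ℂ E)) := by ring
      _ = 2 * finrank ℂ E * (2 * finrank ℂ E) := h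
      _ = 4 * finrank ℂ E ^ 2 := by ring
  omega

/-- **MILNE'S TABLE, TYPE II: `2[F:ℚ] · dim_ℚ Lie S(X) = g² + g[F:ℚ]`** (`dim S(X) = g²/2f + g/2`, `S(X)_{/k^al} ≅ ∏_σ Sp_{g/f}`), for
`End_ℚ(X) = f(F)⟨I, J⟩` with `I† = −I`, `J† = J`. [cite: Milne1999LefschetzClasses, §2 p. 649–650 (type II) and Summary table p. 652 («II ∣ Sp ∣ … ∣ `g²/2f + g/2`»)] -/
theorem two_mul_finrank_mul_finrank_lefschetzLieRat_eq_of_quaternion_of_rosati_eq_self (hGu : IsUnit G.det) (hGt : Gᵀ = -G)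
    (f : K →ₐ[ℚ] Matrix ι ι ℚ) (hfix : ∀ x, rosati G (f x) = f x) {I J : Matrix ι ι ℚ} {a b : K} (ha : a ≠ 0) (hb : b ≠ 0)
    (hI : I * I = f a) (hJ : J * J = f b) (hIJ : I * J = -(J * I)) (hIf : ∀ x, I * f x = f x * I) (hJf : ∀ x, J * f x = f x * J)
    (hE : ∀ B, B ∈ endAlgRat Φ ↔ ∃ c : Fin 4 → K, B = f (c 0) + f (c 1) * I + f (c 2) * J + f (c 3) * (I * J))
    (hIros : rosati G I = -I) (hJros : rosati G J = J) :
    2 * (finrank ℚ K * finrank ℚ (lefschetzLieRat Φ G)) = finrank ℂ E ^ 2 + finrank ℚ K * finrank ℂ E := by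
  have h := eight_mul_finrank_mul_finrank_lefschetzLieRat_eq_of_quaternion_of_rosati_eq_self hGu hGt f hfix ha hb hI hJ hIJ hIf hJf
    hE hIros hJros
  rw [card_eq_two_mul_finrank Φ] at h
  have h' : 4 * (2 * (finrank ℚ K * finrank ℚ (lefschetzLieRat Φ G))) = 4 * (finrank ℂ E ^ 2 + finrank ℚ K * finrank ℂ E) :=
    calc _ = 8 * (finrank ℚ K * finrank ℚ (lefschetzLieRat Φ G)) := by ring
      _ = 2 * finrank ℂ E * (2 * finrank ℂ E) + 2 * (finrank ℚ K * (2 * finrank ℂ E)) := h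
      _ = 4 * (finrank ℂ E ^ 2 + finrank ℚ K * finrank ℂ E) := by ring
  omega

/-- TYPE III in `𝔩𝔣 = Lie Lf(X)(ℝ)` and in `𝔩𝔣_ℂ`: `2[F:ℚ] · dim + g[F:ℚ] = g²`. [cite: Milne1999LefschetzClasses, §2 Summary table p. 652 (type III) and Remark 1.6] -/
theorem two_mul_finrank_mul_finrank_lefschetzLie_add_eq_of_quaternion_of_rosati_eq_neg (hGu : IsUnit G.det) (hGt : Gᵀ = -G)
    (f : K →ₐ[ℚ] Matrix ι ι ℚ) (hfix : ∀ x, rosati G (f x) = f x) {I J : Matrix ι ι ℚ} {a b : K} (ha : a ≠ 0) (hb : b ≠ 0)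
    (hI : I * I = f a) (hJ : J * J = f b) (hIJ : I * J = -(J * I)) (hIf : ∀ x, I * f x = f x * I) (hJf : ∀ x, J * f x = f x * J)
    (hE : ∀ B, B ∈ endAlgRat Φ ↔ ∃ c : Fin 4 → K, B = f (c 0) + f (c 1) * I + f (c 2) * J + f (c 3) * (I * J))
    (hIros : rosati G I = -I) (hJros : rosati G J = -J) :
    2 * (finrank ℚ K * finrank ℝ (lefschetzLie Φ G)) + finrank ℚ K * finrank ℂ E = finrank ℂ E ^ 2 ∧
      2 * (finrank ℚ K * finrank ℂ (lefschetzLieC Φ G)) + finrank ℚ K * finrank ℂ E = finrank ℂ E ^ 2 := by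
  rw [← finrank_lefschetzLieRat_eq_finrank_lefschetzLie, finrank_lefschetzLieC_eq_finrank_lefschetzLieRat Φ G]
  have h := two_mul_finrank_mul_finrank_lefschetzLieRat_add_eq_of_quaternion_of_rosati_eq_neg hGu hGt f hfix ha hb hI hJ hIJ hIf hJf
    hE hIros hJros
  exact ⟨h, h⟩

/-- TYPE II in `𝔩𝔣` and `𝔩𝔣_ℂ`: `2[F:ℚ] · dim = g² + g[F:ℚ]`. [cite: Milne1999LefschetzClasses, §2 Summary table p. 652 (type II) and Remark 1.6] -/
theorem two_mul_finrank_mul_finrank_lefschetzLie_eq_of_quaternion_of_rosati_eq_self (hGu : IsUnit G.det) (hGt : Gᵀ = -G)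
    (f : K →ₐ[ℚ] Matrix ι ι ℚ) (hfix : ∀ x, rosati G (f x) = f x) {I J : Matrix ι ι ℚ} {a b : K} (ha : a ≠ 0) (hb : b ≠ 0)
    (hI : I * I = f a) (hJ : J * J = f b) (hIJ : I * J = -(J * I)) (hIf : ∀ x, I * f x = f x * I) (hJf : ∀ x, J * f x = f x * J)
    (hE : ∀ B, B ∈ endAlgRat Φ ↔ ∃ c : Fin 4 → K, B = f (c 0) + f (c 1) * I + f (c 2) * J + f (c 3) * (I * J))
    (hIros : rosati G I = -I) (hJros : rosati G J = J) :
    2 * (finrank ℚ K * finrank ℝ (lefschetzLie Φ G)) = finrank ℂ E ^ 2 + finrank ℚ K * finrank ℂ E ∧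
      2 * (finrank ℚ K * finrank ℂ (lefschetzLieC Φ G)) = finrank ℂ E ^ 2 + finrank ℚ K * finrank ℂ E := by
  rw [← finrank_lefschetzLieRat_eq_finrank_lefschetzLie, finrank_lefschetzLieC_eq_finrank_lefschetzLieRat Φ G]
  have h := two_mul_finrank_mul_finrank_lefschetzLieRat_eq_of_quaternion_of_rosati_eq_self hGu hGt f hfix ha hb hI hJ hIJ hIf hJf
    hE hIros hJros
  exact ⟨h, h⟩

/-- **THE HODGE BOUND, TYPE III: `2[F:ℚ] · dim_ℝ 𝔥𝔤_ℝ + g[F:ℚ] ≤ g²`** for a polarisation `η` with rational Gram matrix `G`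
(`Hg(X) ⊆ Lf(X)`, Milne «`L(A) ⊃ Hg(A)`»; for type III the bound is strict in general — `S(X)` is not connected, exotic classes).
[cite: Milne1999LefschetzClasses, §4 Remark 4.9 («When `A` has an isogeny factor of type III …») and §2 Summary table p. 652] -/
theorem two_mul_finrank_mul_finrank_hodgeGroupLie_le_of_quaternion_of_rosati_eq_neg (hη : IsRiemannForm Φ η)
    (hG : G.map (Rat.cast : ℚ → ℝ) = latticeGram Φ η) (f : K →ₐ[ℚ] Matrix ι ι ℚ) (hfix : ∀ x, rosati G (f x) = f x)
    {I J : Matrix ι ι ℚ} {a b : K} (ha : a ≠ 0) (hb : b ≠ 0) (hI : I * I = f a) (hJ : J * J = f b) (hIJ : I * J = -(J * I))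
    (hIf : ∀ x, I * f x = f x * I) (hJf : ∀ x, J * f x = f x * J)
    (hE : ∀ B, B ∈ endAlgRat Φ ↔ ∃ c : Fin 4 → K, B = f (c 0) + f (c 1) * I + f (c 2) * J + f (c 3) * (I * J))
    (hIros : rosati G I = -I) (hJros : rosati G J = -J) :
    2 * (finrank ℚ K * finrank ℝ (hodgeGroupLie Φ)) + finrank ℚ K * finrank ℂ E ≤ finrank ℂ E ^ 2 := by
  letI : LieRing (Matrix ι ι ℝ) := LieRing.ofAssociativeRing
  have hGu : IsUnit G.det := isUnit_det_of_map_ratCast hG hη.isUnit_det_latticeGram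
  have hGt : Gᵀ = -G := transpose_eq_neg_of_map_ratCast Φ hG
  have h := (two_mul_finrank_mul_finrank_lefschetzLie_add_eq_of_quaternion_of_rosati_eq_neg hGu hGt f hfix ha hb hI hJ hIJ hIf hJf hE
    hIros hJros).1
  have hle : finrank ℝ (hodgeGroupLie Φ) ≤ finrank ℝ (lefschetzLie Φ G) := Submodule.finrank_mono
    (show (hodgeGroupLie Φ).toSubmodule ≤ (lefschetzLie Φ G).toSubmodule from hη.hodgeGroupLie_le_lefschetzLie hG)
  have := Nat.mul_le_mul_left (finrank ℚ K) hle
  omega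

/-- **THE HODGE BOUND, TYPE II: `2[F:ℚ] · dim_ℝ 𝔥𝔤_ℝ ≤ g² + g[F:ℚ]`** (`Hg(X) ⊆ Lf(X) = Res_{F/ℚ} Sp_{g/[F:ℚ]}`).
[cite: Milne1999LefschetzClasses, §4 («`Hg(A) ⊂ L(A)`») and §2 Summary table p. 652 (type II)] -/
theorem two_mul_finrank_mul_finrank_hodgeGroupLie_le_of_quaternion_of_rosati_eq_self (hη : IsRiemannForm Φ η)
    (hG : G.map (Rat.cast : ℚ → ℝ) = latticeGram Φ η) (f : K →ₐ[ℚ] Matrix ι ι ℚ) (hfix : ∀ x, rosati G (f x) = f x)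
    {I J : Matrix ι ι ℚ} {a b : K} (ha : a ≠ 0) (hb : b ≠ 0) (hI : I * I = f a) (hJ : J * J = f b) (hIJ : I * J = -(J * I))
    (hIf : ∀ x, I * f x = f x * I) (hJf : ∀ x, J * f x = f x * J)
    (hE : ∀ B, B ∈ endAlgRat Φ ↔ ∃ c : Fin 4 → K, B = f (c 0) + f (c 1) * I + f (c 2) * J + f (c 3) * (I * J))
    (hIros : rosati G I = -I) (hJros : rosati G J = J) :
    2 * (finrank ℚ K * finrank ℝ (hodgeGroupLie Φ)) ≤ finrank ℂ E ^ 2 + finrank ℚ K * finrank ℂ E := by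
  letI : LieRing (Matrix ι ι ℝ) := LieRing.ofAssociativeRing
  have hGu : IsUnit G.det := isUnit_det_of_map_ratCast hG hη.isUnit_det_latticeGram
  have hGt : Gᵀ = -G := transpose_eq_neg_of_map_ratCast Φ hG
  have h := (two_mul_finrank_mul_finrank_lefschetzLie_eq_of_quaternion_of_rosati_eq_self hGu hGt f hfix ha hb hI hJ hIJ hIf hJf hE
    hIros hJros).1
  have hle : finrank ℝ (hodgeGroupLie Φ) ≤ finrank ℝ (lefschetzLie Φ G) := Submodule.finrank_mono
    (show (hodgeGroupLie Φ).toSubmodule ≤ (lefschetzLie Φ G).toSubmodule from hη.hodgeGroupLie_le_lefschetzLie hG)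
  have := Nat.mul_le_mul_left (finrank ℚ K) hle
  omega

end Quaternion

end ComplexTorus

end Literature.Geometry.Kaehler
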